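import Literature.Probability.LatticeModels.FKIsingAnnulusCrossingRSW
import Literature.Probability.LatticeModels.FKIsingRSWHolds
import HarnessLib

/-!
# DCS Lemma 6.3 holds: circuits in annuli for the critical FK-Ising model (`fkIsing_annulusCrossing_le`)

Topic `Literature/Probability/LatticeModels` (family `crit-ising`); the discharge of the named fact
`Literature.Probability.LatticeModels.fkIsing_annulusCrossing_le` of `FKIsingRSW.lean` —
Duminil-Copin–Smirnov, Clay Math. Proc. 15 (2012), Lemma 6.3: there is `c < 1` such that for all
`n ≥ 1` the critical FK-Ising measure of the square annulus `S_{n,2n} = [-2n, 2n]² ∖ (-n, n)²`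
wired on its boundary gives probability `≤ c` to an open crossing from the inner to the outer
boundary.

Both halves of the printed proof are already theorems of the tree:

* the conditional reduction `fkIsing_annulusCrossing_le_of_fkIsing_rsw : fkIsing_rsw →
  fkIsing_annulusCrossing_le` (`FKIsingAnnulusCrossingRSW.lean`, with
  `FKIsingAnnulusCrossingProofs.lean`, `FKIsingAnnulusTopRect.lean`,
  `FKIsingWiredRectDuality.lean`: the four rectangles, comparison of boundary conditions and the
  domain Markov property, "wired is dual to free", FKG, and the Russo–Seymour–Welsh gluing);
* DCS Thm. 3.16 itself, `fkIsing_rsw_holds` (`FKIsingRSWHolds.lean`: Duminil-Copin–Hongler–Nolin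
  2011, Thm. 1, through Smirnov's fermionic observable).

This file only composes them (no definition, no named fact).

## References

* H. Duminil-Copin, S. Smirnov, *Conformal invariance of lattice models*, Clay Math. Proc. 15
  (2012) 213–276, arXiv:1109.1549: Thm. 3.16, Lemma 6.3 and its proof (p. 27).
  [DuminilCopinSmirnov2012Clay]
* H. Duminil-Copin, C. Hongler, P. Nolin, Comm. Pure Appl. Math. 64 (2011) 1165–1198, Thm. 1.
  [DuminilCopinHonglerNolin2011]
-/

namespace Literature.Probability.LatticeModels

/-- **Duminil-Copin–Smirnov 2012, Lemma 6.3 (circuits in annuli for critical FK-Ising): the named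
fact `fkIsing_annulusCrossing_le` holds** — the proved reduction to Thm. 3.16
(`fkIsing_annulusCrossing_le_of_fkIsing_rsw`) applied to the proved Thm. 3.16
(`fkIsing_rsw_holds`). [cite: DuminilCopinSmirnov2012Clay, Lemma 6.3 (proof, p. 27) with Thm. 3.16] -/
theorem fkIsing_annulusCrossing_le_holds : fkIsing_annulusCrossing_le :=
  fkIsing_annulusCrossing_le_of_fkIsing_rsw fkIsing_rsw_holds

end Literature.Probability.LatticeModels
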